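import Summits.CriticalPhenomena.PercolationContinuityZ3.Theorems.Transplant.FKConnectivityAllQAntipodalTwoSpinePhiWeight
import HarnessLib

/-!
# Connectivity correlation inequalities for `φ_{w,q}` — TWO-SPINE word model: `phiRun` IS INJECTIVE on non-critical `01`-words

Helper file (`--supports stmt-CriticalPhenomena-4575`), FK sub-lane `prim-bschramm-fk-2` (gen 15/16); builds on p205010 (kernel theorem,
internal audit signed; external expert review pending).  No named facts, no sorries, standard axioms.

Memo `bschramm/FROM-fk-2-g15-TWO-SPINE.md` §12 (V1) / blueprint L2: **`phiRun_injective`** — on words whose side is of type `01` and whose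
top-down run does not reach the root, Theorem U's word-level injection `phiRun r` is injective (so the whole-cell targets `Φ_N(ℓ)` of distinct
non-critical losers are distinct).  Proof by induction on the word: if both runs reach `M_1` the heads are the same flipped `λ` and the ground
tails have equal row exchanges; if neither does, recurse; the mixed case is impossible by the lowest-λ lemma (`…TwoSpineNoCollision`): the
image tail would be an anti-ground word produced from a present root.
[cite: Grimmett2006, §3.8 (pp. 61–62); §3.9 (p. 63)]
-/

namespace Summit.CriticalPhenomena.PercolationContinuityZ3.Theorems

namespace FK

namespace TwoSpine

open X2Word

/-! ### Injectivity of `phiRun` on non-critical `01`-words -/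

/-- `swapLetter` is an involution. [folklore] -/
theorem swapLetter_swapLetter (l : SLetter) : swapLetter (swapLetter l) = l := by
  obtain ⟨k, b, bb⟩ := l; rfl

/-- `map swapLetter` is injective. [folklore] -/
theorem map_swapLetter_injective {v w : List SLetter} (h : v.map swapLetter = w.map swapLetter) : v = w := by
  have := congrArg (List.map swapLetter) h
  simpa [List.map_map, Function.comp_def, swapLetter_swapLetter] using this

/-- In the flipped case of `phiRun_cons'` the tail is ground and its image is the row exchange. [folklore] -/
theorem phiRun_tail_of_reached {r : Bool × Bool} {l : SLetter} {w : List SLetter} (hr : is01 r = false)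
    (hreach : phiReachesRoot (compStep r l) w = true) :
    l.2 = (false, true) ∧ compStep r l = (false, true) ∧ compStep r (l.1, true, false) = (true, false) ∧ isGround w = true ∧
      phiRun (compStep r l) w = w.map swapLetter := by
  have hi : is01 (compStep r l) = true := by
    have h := hreach; simp only [phiReachesRoot, Bool.and_eq_true] at h; exact h.1
  have hc01 : compStep r l = (false, true) := eq_of_is01 hi
  obtain ⟨hl, hflip⟩ := compStep_01_of_not01 hr hc01
  have hground : isGround w = true := by rw [← phiReachesRoot_absent_iff]; rwa [hc01] at hreach
  refine ⟨hl, hc01, hflip, hground, ?_⟩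
  rw [hc01, phiRun_absent_ground hground, swap01_eq_swapLetter_of_ground hground]

/-- **Injectivity** (memo §12 V1): on words whose side is `01` and whose run does not reach the root, `phiRun r` is injective —
distinct non-critical losers have distinct whole-cell targets. [folklore] -/
theorem phiRun_injective {r : Bool × Bool} {w₁ w₂ : List SLetter}
    (h₁ : topComp r w₁ = (false, true)) (n₁ : phiReachesRoot r w₁ = false)
    (h₂ : topComp r w₂ = (false, true)) (n₂ : phiReachesRoot r w₂ = false)
    (heq : phiRun r w₁ = phiRun r w₂) : w₁ = w₂ := by
  induction w₁ generalizing r w₂ with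
  | nil =>
    have : w₂.length = 0 := by simpa using (congrArg List.length heq).symm
    exact (List.length_eq_zero_iff.1 this).symm
  | cons l₁ t₁ ih =>
    obtain _ | ⟨l₂, t₂⟩ := w₂
    · have := congrArg List.length heq; simp at this
    rw [phiRun_cons', phiRun_cons'] at heq
    obtain ⟨hhead, htail⟩ := List.cons.inj heq
    rw [phiReachesRoot_cons] at n₁ n₂
    rw [topComp_cons] at h₁ h₂
    rcases Bool.eq_false_or_eq_true (phiReachesRoot (compStep r l₁) t₁) with r₁ | r₁ <;>
      rcases Bool.eq_false_or_eq_true (phiReachesRoot (compStep r l₂) t₂) with r₂ | r₂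
    · -- both runs reach `M_1`: both heads are flipped `λ`'s with the same kind, both tails ground with equal row exchange
      have hr : is01 r = false := by simpa [r₁] using n₁
      obtain ⟨hl₁, hc₁, -, -, ht₁⟩ := phiRun_tail_of_reached hr r₁
      obtain ⟨hl₂, hc₂, -, -, ht₂⟩ := phiRun_tail_of_reached hr r₂
      rw [r₁, hl₁, r₂, hl₂] at hhead
      simp only [beq_self_eq_true, Bool.and_self, if_true, Prod.mk.injEq] at hhead
      have hl : l₁ = l₂ := by
        obtain ⟨k₁, b₁⟩ := l₁; obtain ⟨k₂, b₂⟩ := l₂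
        simp only at hl₁ hl₂ hhead
        rw [hl₁, hl₂, hhead.1]
      subst hl
      rw [ht₁, ht₂] at htail
      rw [map_swapLetter_injective htail]
    · -- `w₁`'s run reaches `M_1`, `w₂`'s does not: the image tail is anti-ground; lowest-λ lemma
      exfalso
      have hr : is01 r = false := by simpa [r₁] using n₁
      obtain ⟨hl₁, hc₁, hflip₁, hg₁, ht₁⟩ := phiRun_tail_of_reached hr r₁
      rw [r₁, hl₁, r₂] at hhead
      simp only [beq_self_eq_true, Bool.and_self, if_true, Bool.false_and, Bool.false_eq_true, if_false] at hhead
      -- `l₂ = (l₁.1, true, false)`, so `compStep r l₂ = (1,0)` and the tail of `w₂` runs from a PRESENT root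
      rw [← hhead, hflip₁] at htail h₂ r₂
      rw [ht₁] at htail
      have hanti : isAntiGround (t₁.map swapLetter) = true := by
        rw [← swap01_eq_swapLetter_of_ground hg₁]; exact isAntiGround_swap_of_ground hg₁
      by_cases hte : t₂ = t₁.map swapLetter
      · rw [hte, topComp_present_antiGround hanti] at h₂; simp at h₂
      · exact phiRun_present_ne_of_lt_antiGround hanti (htail ▸ phiRun_forall₂ (true, false) t₂) hte htail.symm
    · -- symmetric
      exfalso
      have hr : is01 r = false := by simpa [r₂] using n₂
      obtain ⟨hl₂, hc₂, hflip₂, hg₂, ht₂⟩ := phiRun_tail_of_reached hr r₂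
      rw [r₂, hl₂, r₁] at hhead
      simp only [beq_self_eq_true, Bool.and_self, if_true, Bool.false_and, Bool.false_eq_true, if_false] at hhead
      rw [hhead, hflip₂] at htail h₁ r₁
      rw [ht₂] at htail
      have hanti : isAntiGround (t₂.map swapLetter) = true := by
        rw [← swap01_eq_swapLetter_of_ground hg₂]; exact isAntiGround_swap_of_ground hg₂
      by_cases hte : t₁ = t₂.map swapLetter
      · rw [hte, topComp_present_antiGround hanti] at h₁; simp at h₁
      · exact phiRun_present_ne_of_lt_antiGround hanti (htail ▸ phiRun_forall₂ (true, false) t₁) hte htail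
    · -- neither reaches: equal heads, recurse
      rw [r₁, r₂] at hhead
      simp only [Bool.false_and, Bool.false_eq_true, if_false] at hhead
      subst hhead
      rw [ih h₁ r₁ h₂ r₂ htail]

end TwoSpine

end FK

end Summit.CriticalPhenomena.PercolationContinuityZ3.Theorems
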